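import Mathlib
import Literature.NumberTheory.Irrationality.Brown2016.DinnerParties
import Summits.KontsevichZagierPeriods.Zeta5Search.Families.CellularIntegral
import Summits.KontsevichZagierPeriods.Zeta5Search.Families.BasicConvergence
import Summits.KontsevichZagierPeriods.Zeta5Search.Families.ChordCrossings
import HarnessLib

/-!
# ζ(5) search — Families: Brown's Lemma 3.6 / 3.8 for EVERY `n` — basic cellular integrals converge (combinatorially) iff the seating is convergent

HONEST FRAMING: systematic search; no irrationality claim unless certified.

Cell `pub-zeta5`, seat P2.  `Families/BasicConvergence.lean` certified Brown's convergence condition for the basic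
cellular integrals of the 105 + 771 listed `N = 9, 10` configurations by kernel evaluation of the count criterion
`ConstOK`.  This file replaces the enumeration by the THEOREM behind it, valid for every `n = ℓ + 3 ≥ 3` and every
seating `σ : ℤ/n → ℤ/n` (bijective):

* `Convergent σ` — Brown's dinner-party condition on `Fin n` ("no set of `k` consecutive elements
  `{σ_i, …, σ_{i+k−1}}` is a set of consecutive integers mod `n`, `2 ≤ k ≤ n−2`" [Brown2016, §1.5, §3.1]),
  decidable; `WindowInBlock σ s k` its negated atoms;
* `sameSide_eq_ite`, `cntS_eq_sub_card_bdry` — Brown's indicator `2·𝕀_D` [Brown2016, §3.4] of the chord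
  `D = {p,…,p+k−1}` counts the edges of the polygon `σδ⁰` NOT cut by the chord: `cntS σ p k = n − #crossings`;
  `cntId_eq` — the standard polygon is cut exactly twice (`cntId = n − 2`);
* `four_le_card_bdry_of_convergent` — **a convergent seating crosses every proper chord at least four times**
  (the quantitative form of [Brown2016, Lemma 3.8]: `𝕀_D(σ) ≤ n/2 − 1` with equality iff `D ∈ σ_f`);
* `constOK_of_convergent`, `brownConvergent_basic_of_convergent` — hence `ConstOK σ` and Brown's convergence
  condition `BrownConvergent σ N N` for EVERY `N ≥ 0` [Brown2016, Lemma 3.6, §3.4 "Proof of convergence"];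
* `twoOrd_basic_of_windowInBlock`, `not_brownConvergent_basic_of_windowInBlock` — conversely a window seated onto
  a block is a chord COMMON to `δ⁰` and `σδ⁰`, along which `2·ord(f_σ^N ω_σ) = −2` for every `N`;
* `two_mul_le_twoOrd_basic_of_convergent` — Brown's Remark 3.10 for every `n`: a convergent seating's basic form
  vanishes to order `≥ N` along every divisor at finite distance (`2·ord_D ≥ 2N`);
* `slope`, `twoOrd_ray`, `brownConvergent_ray_iff` — along a ray of exponents `(N·α, N·β)` the chord valuation is
  `N·slope + (ℓ − 1 − cntS)`; for convergent `σ` the whole ray is Brown-convergent iff every chord slope is `≥ 0`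
  (the convergence region of a one-parameter cellular family is the cone of the chord forms); basic ray: slopes `≥ 2`;
* `brownConvergent_basic_iff_convergent`, `constOK_iff_convergent` — **for bijective `σ` and `N ≥ 0`:
  `BrownConvergent σ N N ↔ Convergent σ ↔ ConstOK σ`** [Brown2016, §1.5: "It converges if and only if `σ` is a
  convergent permutation"; Lemma 3.6].
The analytic identification of `BrownConvergent` with integrability [Brown2016, §2.4, (2.3)] is not asserted (as in
`Families/CellularIntegral.lean`).  The link with the printed-list predicate `Brown2016.IsConvergent` / `ofSeating`
is in `Families/ConvergentSeating.lean` (if present).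
-/
noncomputable section

namespace Summit.KontsevichZagierPeriods.Zeta5Search.Families.Cellular

open Finset

variable {ℓ : ℕ}

/-! ### Brown's `sameSide` through the arcs `arc p k = {p, …, p+k−1}` -/

/-- The chord set `S = {p, …, p+k−1}` of [Brown2016, §3.4] is the arc `arc p k`: Brown's indicator
`sameSide p k u v` is `1` iff `u, v` lie on the same side of the cut `S | Sᶜ`. -/
theorem sameSide_eq_ite (p : Fin (ℓ + 3)) (k : ℕ) (u v : Fin (ℓ + 3)) :
    sameSide (ℓ := ℓ) (p : ℕ) k u v = if (u ∈ arc p k ↔ v ∈ arc p k) then 1 else 0 := by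
  have key : ∀ w : Fin (ℓ + 3),
      ((w.val + (ℓ + 3) - (p : ℕ) % (ℓ + 3)) % (ℓ + 3) < k) ↔ w ∈ arc p k := by
    intro w
    rw [mem_arc, Fin.sub_def, Nat.mod_eq_of_lt p.isLt]
    have : w.val + (ℓ + 3) - (p : ℕ) = (ℓ + 3) - (p : ℕ) + w.val := by
      have := p.isLt
      omega
    simp [this]
  unfold sameSide
  simp only [key]

/-- The number of edges of `σδ⁰` not separated by the chord `(p,k)` is `n` minus the number of crossings
of the cut by the Hamiltonian cycle `σ`: `cntS σ p k = n − #bdry {i | σ_i ∈ S}`. [Brown2016, §3.4 (`2·𝕀_D(σ)`)] -/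
theorem cntS_eq_sub_card_bdry (σ : Fin (ℓ + 3) → Fin (ℓ + 3)) (p : Fin (ℓ + 3)) (k : ℕ) :
    cntS σ (p : ℕ) k = ((ℓ : ℤ) + 3) - ((bdry (univ.filter fun i => σ i ∈ arc p k)).card : ℤ) := by
  unfold cntS
  simp only [sameSide_eq_ite]
  rw [Finset.sum_boole]
  have hsplit := card_filter_add_card_filter_not (s := (univ : Finset (Fin (ℓ + 3))))
    (fun i => (σ i ∈ arc p k ↔ σ (i + 1) ∈ arc p k))
  have hb : bdry (univ.filter fun i => σ i ∈ arc p k) =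
      univ.filter (fun i => ¬ (σ i ∈ arc p k ↔ σ (i + 1) ∈ arc p k)) := by
    ext i
    simp [bdry]
  rw [hb]
  simp only [card_univ, Fintype.card_fin] at hsplit
  omega

/-- The standard polygon `δ⁰` itself meets every proper chord cut exactly twice:
`cntId p k = n − 2` for `1 ≤ k ≤ n − 1`. [Brown2016, Lemma 3.8 (case of equality)] -/
theorem cntId_eq (p : Fin (ℓ + 3)) {k : ℕ} (h1 : 1 ≤ k) (hk : k ≤ ℓ + 2) :
    cntId ℓ (p : ℕ) k = (ℓ : ℤ) + 1 := by
  have h := cntS_eq_sub_card_bdry (ℓ := ℓ) id p k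
  have hT : (univ.filter fun i : Fin (ℓ + 3) => id i ∈ arc p k) = arc p k := by
    ext i
    simp
  rw [hT, card_bdry_arc p h1 hk] at h
  unfold cntS at h
  unfold cntId
  simp only [id] at h
  rw [h]
  push_cast
  ring

/-- For a bijective seating, the set of positions seated into the chord set `S(p,k)` has `k` elements. -/
theorem card_filter_mem_arc {σ : Fin (ℓ + 3) → Fin (ℓ + 3)} (hσ : Function.Bijective σ)
    (p : Fin (ℓ + 3)) {k : ℕ} (hk : k ≤ ℓ + 3) :
    (univ.filter fun i => σ i ∈ arc p k).card = k := by
  calc (univ.filter fun i => σ i ∈ arc p k).card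
      = ((univ.filter fun i => σ i ∈ arc p k).image σ).card :=
        (card_image_of_injective _ hσ.injective).symm
    _ = (arc p k).card := by
        congr 1
        ext v
        simp only [mem_image, mem_filter, mem_univ, true_and]
        constructor
        · rintro ⟨i, hi, rfl⟩
          exact hi
        · intro hv
          obtain ⟨i, rfl⟩ := hσ.surjective v
          exact ⟨i, hv, rfl⟩
    _ = k := card_arc p hk

/-! ### Convergent seatings (Brown's dinner-party condition) at the level of `Fin n` -/

/-- The window of `k` cyclically consecutive positions `{s, …, s+k−1}` is seated by `σ` into a block of
`k` cyclically consecutive places `{a, …, a+k−1}`. [Brown2016, §1.5, §3.1] -/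
def WindowInBlock (σ : Fin (ℓ + 3) → Fin (ℓ + 3)) (s : Fin (ℓ + 3)) (k : ℕ) : Prop :=
  ∃ a : Fin (ℓ + 3), ∀ i : Fin (ℓ + 3), i ∈ arc s k → σ i ∈ arc a k

/-- `WindowInBlock` is decidable. -/
instance instDecidableWindowInBlock (σ : Fin (ℓ + 3) → Fin (ℓ + 3)) (s : Fin (ℓ + 3)) (k : ℕ) :
    Decidable (WindowInBlock σ s k) := by
  unfold WindowInBlock; infer_instance

/-- **Brown's convergence condition** for a seating `σ : ℤ/n → ℤ/n` (position `i` ↦ guest `σ i`), stated on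
`Fin n`: "no set of `k` consecutive elements `{σ_i, σ_{i+1}, …, σ_{i+k−1}}` is itself a set of consecutive
integers modulo `n`, for all `2 ≤ k ≤ n − 2`". (For the printed list form see
`Literature…Brown2016.IsConvergent`.) [Brown2016, §1.5; §3.1] -/
def Convergent (σ : Fin (ℓ + 3) → Fin (ℓ + 3)) : Prop :=
  ∀ s : Fin (ℓ + 3), ∀ k : ℕ, k < ℓ + 2 → 2 ≤ k → ¬ WindowInBlock σ s k

/-- `Convergent σ` is decidable (finitely many windows and blocks). -/
instance instDecidableConvergent (σ : Fin (ℓ + 3) → Fin (ℓ + 3)) : Decidable (Convergent σ) := by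
  unfold Convergent; infer_instance

/-! ### Brown's Lemma 3.6 / 3.8 in combinatorial form, for every `n` -/

/-- **Four crossings.** For a bijective convergent seating `σ`, the Hamiltonian cycle `σ_0 σ_1 ⋯ σ_{n−1}`
crosses every proper chord cut `S = {p,…,p+k−1} | Sᶜ` (`2 ≤ k ≤ n−2`) at least four times.
[Brown2016, proof of Lemma 3.8] -/
theorem four_le_card_bdry_of_convergent {σ : Fin (ℓ + 3) → Fin (ℓ + 3)} (hσ : Function.Bijective σ)
    (hc : Convergent σ) (p : Fin (ℓ + 3)) {k : ℕ} (hk2 : 2 ≤ k) (hk : k ≤ ℓ + 1) :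
    4 ≤ (bdry (univ.filter fun i => σ i ∈ arc p k)).card := by
  have hTcard : (univ.filter fun i => σ i ∈ arc p k).card = k := card_filter_mem_arc hσ p (by omega)
  refine four_le_card_bdry ?_ ?_ ?_
  · rw [← Finset.card_pos, hTcard]
    omega
  · intro h
    have := congrArg Finset.card h
    rw [hTcard, card_univ, Fintype.card_fin] at this
    omega
  · rintro ⟨s, hs⟩
    rw [hTcard] at hs
    refine hc s k (by omega) hk2 ⟨p, fun i hi => ?_⟩
    have : i ∈ (univ.filter fun i => σ i ∈ arc p k) := hs ▸ hi
    simpa using this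

/-- **Four crossings ⇒ the count criterion.** For a bijective convergent seating `σ`, every chord
`S = {p,…,p+k−1}` (`2 ≤ k ≤ n−2`) separates at least four edges of the polygon `σδ⁰`
(`cntS σ p k ≤ n − 4`), and exactly two edges of `δ⁰` (`cntId p k = n − 2`); hence `ConstOK σ`.
[Brown2016, Lemma 3.8 and its proof] -/
theorem constOK_of_convergent {σ : Fin (ℓ + 3) → Fin (ℓ + 3)} (hσ : Function.Bijective σ)
    (hc : Convergent σ) : ConstOK σ := by
  intro p k'
  have hk' := k'.isLt
  have h4 := four_le_card_bdry_of_convergent hσ hc p (k := (k' : ℕ) + 2) (by omega) (by omega)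
  have hS := cntS_eq_sub_card_bdry σ p ((k' : ℕ) + 2)
  have hI := cntId_eq p (k := (k' : ℕ) + 2) (by omega) (by omega)
  rw [hS, hI]
  constructor <;> omega

/-- **Brown's Lemma 3.6, combinatorial half, for every `n` and every exponent `N ≥ 0`**: if the seating
`σ` is convergent then the basic cellular integrand `f_σ^N ω_σ` has non-negative order of vanishing along
every divisor at finite distance with respect to `δ⁰` (`BrownConvergent`). [Brown2016, Lemma 3.6, §3.4] -/
theorem brownConvergent_basic_of_convergent {σ : Fin (ℓ + 3) → Fin (ℓ + 3)} (hσ : Function.Bijective σ)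
    (hc : Convergent σ) {N : ℤ} (hN : 0 ≤ N) : BrownConvergent σ (fun _ => N) (fun _ => N) :=
  brownConvergent_const_of_constOK (constOK_of_convergent hσ hc) hN

/-- **A window seated onto a block gives a pole.** If the window `{s,…,s+k−1}` (`1 ≤ k ≤ n−1`) of a
bijective seating is seated into the block `{a,…,a+k−1}`, then along the divisor of the chord `(a,k)`
the basic form has `2·ord = −2` for EVERY `N` (the chord is common to `δ⁰` and `σδ⁰`:
`ord_D f_σ = 0`, `ord_D ω_σ = −1`). [Brown2016, §3.4, proof of Lemma 3.6 ("if `D ∈ δ_f ∩ δ'_f` …")] -/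
theorem twoOrd_basic_of_windowInBlock {σ : Fin (ℓ + 3) → Fin (ℓ + 3)} (hσ : Function.Bijective σ)
    {s a : Fin (ℓ + 3)} {k : ℕ} (h1 : 1 ≤ k) (hk : k ≤ ℓ + 2)
    (hw : ∀ i : Fin (ℓ + 3), i ∈ arc s k → σ i ∈ arc a k) (N : ℤ) :
    twoOrd σ (fun _ => N) (fun _ => N) (a : ℕ) k = -2 := by
  rw [twoOrd_const]
  have hT : (univ.filter fun i => σ i ∈ arc a k) = arc s k := by
    symm
    apply eq_of_subset_of_card_le
    · intro i hi
      simpa using hw i hi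
    · rw [card_filter_mem_arc hσ a (by omega), card_arc s (by omega)]
  have hS := cntS_eq_sub_card_bdry σ a k
  rw [hT, card_bdry_arc s h1 hk] at hS
  have hI := cntId_eq a (k := k) h1 hk
  rw [hS, hI]
  push_cast
  ring

/-- Hence a non-convergent bijective seating violates Brown's convergence condition for EVERY `N`.
[Brown2016, Lemma 3.6] -/
theorem not_brownConvergent_basic_of_windowInBlock {σ : Fin (ℓ + 3) → Fin (ℓ + 3)}
    (hσ : Function.Bijective σ) {s : Fin (ℓ + 3)} {k : ℕ} (hk2 : 2 ≤ k) (hk : k ≤ ℓ + 1)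
    (hw : WindowInBlock σ s k) (N : ℤ) : ¬ BrownConvergent σ (fun _ => N) (fun _ => N) := by
  obtain ⟨a, ha⟩ := hw
  intro hB
  have h := hB a ⟨k - 2, by omega⟩
  have hk' : ((⟨k - 2, by omega⟩ : Fin ℓ) : ℕ) + 2 = k := by
    show k - 2 + 2 = k
    omega
  rw [hk', twoOrd_basic_of_windowInBlock hσ (by omega) (by omega) ha N] at h
  omega

/-- **Brown's Lemma 3.6 in combinatorial form, for every `n`.** For a bijective seating `σ` and any
`N ≥ 0`: the basic cellular form `f_σ^N ω_σ` satisfies Brown's convergence condition (no pole along any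
divisor at finite distance w.r.t. `δ⁰`) if and only if `σ` is a convergent seating — in particular the
condition does not depend on `N ≥ 0`. [Brown2016, §1.5 ("It converges if and only if `σ` is a convergent
permutation"), Lemma 3.6, Lemma 3.8, §3.4] -/
theorem brownConvergent_basic_iff_convergent {σ : Fin (ℓ + 3) → Fin (ℓ + 3)}
    (hσ : Function.Bijective σ) {N : ℤ} (hN : 0 ≤ N) :
    BrownConvergent σ (fun _ => N) (fun _ => N) ↔ Convergent σ := by
  constructor
  · intro hB s k hk hk2 hw
    exact not_brownConvergent_basic_of_windowInBlock hσ hk2 (by omega) hw N hB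
  · intro hc
    exact brownConvergent_basic_of_convergent hσ hc hN

/-- The count criterion is likewise EQUIVALENT to convergence (for bijective seatings). -/
theorem constOK_iff_convergent {σ : Fin (ℓ + 3) → Fin (ℓ + 3)} (hσ : Function.Bijective σ) :
    ConstOK σ ↔ Convergent σ := by
  constructor
  · intro h
    exact (brownConvergent_basic_iff_convergent hσ le_rfl).1 (brownConvergent_const_of_constOK h le_rfl)
  · exact constOK_of_convergent hσ

/-! ### Sanity checks on printed plans (kernel decisions) -/

/-- Brown's unique `N = 5` configuration `₅π = (5,2,4,1,3)` is convergent. [Brown2016, App. 2 §10.1.1] -/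
example : Convergent (ofSeating (ℓ := 2) [5, 2, 4, 1, 3]) := by decide

/-- Brown's example `(2,4,1,3,6,8,5,7)` solves the classical dinner-table problem but is NOT convergent
(the window `{2,4,1,3}`). [Brown2016, §1.5] -/
example : ¬ Convergent (ofSeating (ℓ := 5) [2, 4, 1, 3, 6, 8, 5, 7]) := by decide

/-- The Brown–Zudilin configuration `₈π₈^∨ = (8,2,4,1,7,5,3,6)` is convergent. [Brown2016, App. 2 §10.1.4] -/
example : Convergent (ofSeating (ℓ := 5) [8, 2, 4, 1, 7, 5, 3, 6]) := by decide

/-! ### Order of vanishing `≥ N` (Brown's Remark 3.10) -/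

/-- **Brown's Remark 3.10, for every `n`.** For a bijective convergent seating `σ` and `N ≥ 0`, the basic cellular form
`f_σ^N ω_σ` vanishes to order at least `N` along EVERY divisor at finite distance with respect to `δ⁰`
(`2·ord_D ≥ 2N`): "when the integral converges, its integrand vanishes to order at least `N` along every boundary
component … This explains why it decays rapidly as `N → ∞`". [Brown2016, Remark 3.10, Corollary 3.9] -/
theorem two_mul_le_twoOrd_basic_of_convergent {σ : Fin (ℓ + 3) → Fin (ℓ + 3)} (hσ : Function.Bijective σ)
    (hc : Convergent σ) {N : ℤ} (hN : 0 ≤ N) (p : Fin (ℓ + 3)) {k : ℕ} (hk2 : 2 ≤ k) (hk : k ≤ ℓ + 1) :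
    2 * N ≤ twoOrd σ (fun _ => N) (fun _ => N) (p : ℕ) k := by
  rw [twoOrd_const]
  have h4 := four_le_card_bdry_of_convergent hσ hc p hk2 hk
  have hS := cntS_eq_sub_card_bdry σ p k
  have hI := cntId_eq p (k := k) (by omega) (by omega)
  rw [hS, hI]
  nlinarith

/-- The same bound in Brown's indexing of the chords (`k = k' + 2`, `k' : Fin ℓ`), i.e. for every divisor quantified
in `BrownConvergent`. [Brown2016, Remark 3.10] -/
theorem two_mul_le_twoOrd_basic_of_convergent' {σ : Fin (ℓ + 3) → Fin (ℓ + 3)} (hσ : Function.Bijective σ)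
    (hc : Convergent σ) {N : ℤ} (hN : 0 ≤ N) (p : Fin (ℓ + 3)) (k' : Fin ℓ) :
    2 * N ≤ twoOrd σ (fun _ => N) (fun _ => N) (p : ℕ) ((k' : ℕ) + 2) :=
  two_mul_le_twoOrd_basic_of_convergent hσ hc hN p (by omega) (by have := k'.isLt; omega)

/-! ### Rays of exponents: the convergence cone of a one-parameter cellular family -/

/-- The SLOPE of Brown's chord valuation along the ray of exponents `N ↦ (N·α, N·β)`:
`Σ_i c_D(i,i+1) α_i − Σ_i c_D(σ_i,σ_{i+1}) β_i` for the chord `D = (p,k)`. [Brown2016, §3.4 (3.8)] -/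
def slope (σ : Fin (ℓ + 3) → Fin (ℓ + 3)) (α β : Fin (ℓ + 3) → ℤ) (p k : ℕ) : ℤ :=
  (∑ i : Fin (ℓ + 3), sameSide p k i (i + 1) * α i) - ∑ i : Fin (ℓ + 3), sameSide p k (σ i) (σ (i + 1)) * β i

/-- Brown's chord valuation is affine along rays of exponents:
`twoOrd σ (N·α) (N·β) = N · slope + (ℓ − 1 − cntS)` (the constant term is `2·ord_D ω_σ`). [Brown2016, §3.4 (3.8), Lemma 3.11] -/
theorem twoOrd_ray (σ : Fin (ℓ + 3) → Fin (ℓ + 3)) (α β : Fin (ℓ + 3) → ℤ) (N : ℤ) (p k : ℕ) :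
    twoOrd σ (fun i => N * α i) (fun i => N * β i) p k = N * slope σ α β p k + ((ℓ : ℤ) - 1 - cntS σ p k) := by
  unfold twoOrd slope cntS
  simp only [mul_sub, Finset.mul_sum]
  have h : ∀ i : Fin (ℓ + 3), sameSide p k (σ i) (σ (i + 1)) * (N * β i + 1) =
      N * (sameSide p k (σ i) (σ (i + 1)) * β i) + sameSide p k (σ i) (σ (i + 1)) := fun i => by ring
  simp only [h, Finset.sum_add_distrib]
  have h2 : ∀ i : Fin (ℓ + 3), sameSide p k i (i + 1) * (N * α i) = N * (sameSide p k i (i + 1) * α i) :=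
    fun i => by ring
  simp only [h2]
  ring

/-- **Convergence along a whole ray of exponents.** For a bijective convergent seating `σ` and exponent directions
`α, β`, the generalised cellular forms `f_σ(N·α, N·β) ω_σ` satisfy Brown's convergence condition for EVERY `N ≥ 0` iff every
chord slope is non-negative — the convergence region of a one-parameter cellular family is the cone cut out by the chord
forms (for the basic ray `α = β = 1` every slope is `≥ 2` by the four-crossings theorem). [Brown2016, §2.4 (2.3), §3.4, §5.2] -/
theorem brownConvergent_ray_iff {σ : Fin (ℓ + 3) → Fin (ℓ + 3)} (hσ : Function.Bijective σ) (hc : Convergent σ)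
    (α β : Fin (ℓ + 3) → ℤ) :
    (∀ N : ℤ, 0 ≤ N → BrownConvergent σ (fun i => N * α i) (fun i => N * β i)) ↔
      ∀ p : Fin (ℓ + 3), ∀ k' : Fin ℓ, 0 ≤ slope σ α β (p : ℕ) ((k' : ℕ) + 2) := by
  have hOK := constOK_of_convergent hσ hc
  constructor
  · intro h p k'
    by_contra hneg
    push Not at hneg
    -- at `N = ℓ`: `ℓ·slope + (ℓ − 1 − cntS) ≤ −ℓ + ℓ − 1 − cntS < 0` because `cntS = n − #crossings ≥ 0`
    have hB := h (ℓ : ℤ) (by positivity) p k'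
    rw [twoOrd_ray] at hB
    have hS := cntS_eq_sub_card_bdry σ p ((k' : ℕ) + 2)
    have hcard : (bdry (univ.filter fun i => σ i ∈ arc p ((k' : ℕ) + 2))).card ≤ ℓ + 3 :=
      (card_le_univ _).trans (by simp)
    have : (ℓ : ℤ) * slope σ α β (p : ℕ) ((k' : ℕ) + 2) ≤ -(ℓ : ℤ) := by nlinarith
    omega
  · intro h N hN p k'
    rw [twoOrd_ray]
    have h1 := h p k'
    have h2 := (hOK p k').2
    nlinarith

/-- The basic ray as the special case `α = β = 1`: every chord slope of a convergent bijective seating is at least `2`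
(`cntId − cntS ≥ (n−2) − (n−4)`). [Brown2016, Lemma 3.8] -/
theorem two_le_slope_one_of_convergent {σ : Fin (ℓ + 3) → Fin (ℓ + 3)} (hσ : Function.Bijective σ)
    (hc : Convergent σ) (p : Fin (ℓ + 3)) (k' : Fin ℓ) :
    2 ≤ slope σ (fun _ => 1) (fun _ => 1) (p : ℕ) ((k' : ℕ) + 2) := by
  have hk' := k'.isLt
  have h4 := four_le_card_bdry_of_convergent hσ hc p (k := (k' : ℕ) + 2) (by omega) (by omega)
  have hS := cntS_eq_sub_card_bdry σ p ((k' : ℕ) + 2)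
  have hI := cntId_eq p (k := (k' : ℕ) + 2) (by omega) (by omega)
  have : slope σ (fun _ => 1) (fun _ => 1) (p : ℕ) ((k' : ℕ) + 2) = cntId ℓ (p : ℕ) ((k' : ℕ) + 2) - cntS σ p ((k' : ℕ) + 2) := by
    unfold slope cntId cntS
    simp only [mul_one]
  rw [this, hI, hS]
  omega

end Summit.KontsevichZagierPeriods.Zeta5Search.Families.Cellular

end
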